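import Mathlib
import Summits.Ventures.PercRepro2.SwOutCrossGenFar
import Summits.Ventures.PercRepro2.SwOutCrossGenMin

/-!
# The far-arm layer over the minimal fibre record (blind cell PercRepro2, night-4 g25,
2026-08-28; proofs/NIGHT4-G25.md §3)

`SwOutCrossGenFar` adds the far arms to the cube of a `FibreData` and derives the inequality with
far arms from `card_le_crossGen`.  The same construction over the minimal record `FibreMin`
(`ERFM`, `EBTM`, `EBFM`, `typFM`, `BetterFM`, `IsUpFM`, `QFM`; the far-arm-independent pieces
`PtFG`, `AtomFG`, `farAtoms`, `TypFG`, the slices are reused), with the inequality of the record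
as the HYPOTHESIS: **`card_le_crossGenFarM`**: `IneqM F ι → ` the inequality with far arms.
The proof is that of `card_le_crossGenFar` verbatim (the frozen inequality at fixed far bits,
then the far-arm cube principle at a fixed point).
-/

namespace Summit.Ventures.PercRepro2

namespace CrossArm

open LocRows

variable {W A L : Type*} {F : FibreMin W A L} {ι κ : Type*}

open scoped Classical

section Defs

variable (F)

/-- The red atoms of a point with far arms. -/
def ERFM (x : PtFG W ι κ) : Set (AtomFG A ι κ) := Sum.inl '' ERM F x.2 ∪ farAtoms x.1

/-- The blue atoms of `q` together with the red far arms of `f` (the far arms frozen). -/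
def EBTM (x : PtFG W ι κ) : Set (AtomFG A ι κ) := Sum.inl '' EBM F x.2 ∪ farAtoms x.1

/-- The blue atoms of a point with far arms. -/
def EBFM (x : PtFG W ι κ) : Set (AtomFG A ι κ) := Sum.inl '' EBM F x.2 ∪ farAtoms (flipAll x.1)

/-- The type of a point with far arms. -/
def typFM (x : PtFG W ι κ) : TypFG L ι κ := (x.1, typM F x.2)

/-- `t'` is at least as good a type as `t`: no more red far arms, and better on the rest. -/
def BetterFM (t' t : TypFG L ι κ) : Prop :=
  (∀ k, t.1 k = false → t'.1 k = false) ∧ BetterM F t'.2 t.2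

/-- An up-set of types with far arms. -/
def IsUpFM (𝒯 : Set (TypFG L ι κ)) : Prop := ∀ t ∈ 𝒯, ∀ t', BetterFM F t' t → t' ∈ 𝒯

variable [Fintype ι] [DecidableEq ι] [Fintype κ] [DecidableEq κ] [Fintype W] [DecidableEq W]

/-- The non-leaking points with far arms whose type lies in `𝒯`. -/
noncomputable def QFM (𝒯 : Set (TypFG L ι κ)) : Finset (PtFG W ι κ) :=
  Finset.univ.filter fun x => ¬ LeakM F x.2 ∧ typFM F x ∈ 𝒯

end Defs

section Pure

variable {𝒯 : Set (TypFG L ι κ)} {𝓔 : Set (Set (AtomFG A ι κ))}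

/-- The slice of an up-set of types is an up-set. -/
lemma isUpM_sliceTM (h𝒯 : IsUpFM F 𝒯) (f : Config κ) : IsUpM F (sliceTG 𝒯 f) :=
  fun _ ht _ hb => h𝒯 _ ht _ ⟨fun _ h => h, hb⟩

/-- `EBFM` is `EBTM` at the flipped far arms. -/
lemma EBFM_eq (x : PtFG W ι κ) : EBFM F x = EBTM F (flipAll x.1, x.2) := rfl

/-- The far-arm fibre of `QFM` at `q`. -/
def DqM (F : FibreMin W A L) (𝒯 : Set (TypFG L ι κ)) (q : PtG W ι) : Set (Config κ) :=
  {f | (f, typM F q) ∈ 𝒯}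

/-- The far-arm fibre is a lower set. -/
lemma isLowerSet_DqM (h𝒯 : IsUpFM F 𝒯) (q : PtG W ι) : IsLowerSet (DqM F 𝒯 q) := by
  intro f f' hle hf
  refine h𝒯 _ hf _ ⟨fun k hk => ?_, ⟨fun _ h => h, F.betterL_refl _⟩⟩
  have := hle k
  simp only at hk ⊢
  rw [hk] at this
  cases h' : f' k with
  | false => rfl
  | true =>
    rw [h'] at this
    exact absurd (Bool.le_iff_imp.1 this rfl) (by decide)

end Pure

section Thm

variable [Fintype ι] [DecidableEq ι] [Fintype κ] [DecidableEq κ] [Fintype W] [DecidableEq W]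
  {𝒯 : Set (TypFG L ι κ)} {𝓔 : Set (Set (AtomFG A ι κ))}

omit [DecidableEq W] in
/-- Membership in `QFM`. -/
lemma mem_QFM {x : PtFG W ι κ} : x ∈ QFM F 𝒯 ↔ ¬ LeakM F x.2 ∧ typFM F x ∈ 𝒯 := by
  simp only [QFM, Finset.mem_filter, Finset.mem_univ, true_and]

variable [Nonempty ι]

omit [DecidableEq W] [Nonempty ι] in
/-- **Step 1, the frozen inequality at fixed `f`**: the fibre of `QFM F` at `f` is `QM F` of the sliced
up-set, and the inequality is the hypothesis `hineq`. -/
lemma card_frozen_leM (hineq : IneqM F (ι := ι)) (h𝒯 : IsUpFM F 𝒯) (h𝓔 : IsUpperSet 𝓔) (f : Config κ) :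
    ((QFM F 𝒯).filter fun x => x.1 = f ∧ ERFM F x ∈ 𝓔).card ≤
      ((QFM F 𝒯).filter fun x => x.1 = f ∧ EBTM F x ∈ 𝓔).card := by
  have key := hineq _ _ (isUpM_sliceTM h𝒯 f) (isUpperSet_sliceEG h𝓔 f)
  have e1 : ((QFM F 𝒯).filter fun x => x.1 = f ∧ ERFM F x ∈ 𝓔).card =
      ((QM F (sliceTG 𝒯 f)).filter fun q => ERM F q ∈ sliceEG 𝓔 f).card := by
    refine Finset.card_bij' (fun x _ => x.2) (fun q _ => (f, q)) ?_ ?_ ?_ ?_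
    · intro x hx
      rw [Finset.mem_filter, mem_QFM] at hx
      obtain ⟨⟨hl, ht⟩, hf, hE⟩ := hx
      rw [Finset.mem_filter, mem_QM]
      refine ⟨⟨hl, ?_⟩, ?_⟩
      · show (f, typM F x.2) ∈ 𝒯
        rw [← hf]; exact ht
      · show Sum.inl '' ERM F x.2 ∪ farAtoms f ∈ 𝓔
        rw [← hf]; exact hE
    · intro q hq
      rw [Finset.mem_filter, mem_QM] at hq
      obtain ⟨⟨hl, ht⟩, hE⟩ := hq
      rw [Finset.mem_filter, mem_QFM]
      exact ⟨⟨hl, ht⟩, rfl, hE⟩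
    · intro x hx
      rw [Finset.mem_filter] at hx
      exact Prod.ext hx.2.1.symm rfl
    · intro q _
      rfl
  have e2 : ((QFM F 𝒯).filter fun x => x.1 = f ∧ EBTM F x ∈ 𝓔).card =
      ((QM F (sliceTG 𝒯 f)).filter fun q => EBM F q ∈ sliceEG 𝓔 f).card := by
    refine Finset.card_bij' (fun x _ => x.2) (fun q _ => (f, q)) ?_ ?_ ?_ ?_
    · intro x hx
      rw [Finset.mem_filter, mem_QFM] at hx
      obtain ⟨⟨hl, ht⟩, hf, hE⟩ := hx
      rw [Finset.mem_filter, mem_QM]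
      refine ⟨⟨hl, ?_⟩, ?_⟩
      · show (f, typM F x.2) ∈ 𝒯
        rw [← hf]; exact ht
      · show Sum.inl '' EBM F x.2 ∪ farAtoms f ∈ 𝓔
        rw [← hf]; exact hE
    · intro q hq
      rw [Finset.mem_filter, mem_QM] at hq
      obtain ⟨⟨hl, ht⟩, hE⟩ := hq
      rw [Finset.mem_filter, mem_QFM]
      exact ⟨⟨hl, ht⟩, rfl, hE⟩
    · intro x hx
      rw [Finset.mem_filter] at hx
      exact Prod.ext hx.2.1.symm rfl
    · intro q _
      rfl
  rw [e1, e2]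
  exact key

omit [Nonempty ι] in
/-- **Step 2, the far-arm cube principle at fixed `q`**: `EBTM` counts at most as much as `EBFM`. -/
lemma card_far_leM (h𝒯 : IsUpFM F 𝒯) (h𝓔 : IsUpperSet 𝓔) (q : PtG W ι) :
    ((QFM F 𝒯).filter fun x => x.2 = q ∧ EBTM F x ∈ 𝓔).card ≤
      ((QFM F 𝒯).filter fun x => x.2 = q ∧ EBFM F x ∈ 𝓔).card := by
  by_cases hl : LeakM F q
  · have h0 : ((QFM F 𝒯).filter fun x => x.2 = q ∧ EBTM F x ∈ 𝓔) = ∅ := by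
      rw [Finset.filter_eq_empty_iff]
      rintro x hx ⟨hq, -⟩
      exact (mem_QFM.1 hx).1 (hq ▸ hl)
    rw [h0, Finset.card_empty]
    exact Nat.zero_le _
  -- the counts over the far-arm cube
  set A : Set (Config κ) := {f | Sum.inl '' EBM F q ∪ farAtoms f ∈ 𝓔} with hA
  have hAup : IsUpperSet A := fun f f' hle hf => h𝓔 (Set.union_subset_union_right _ (farAtoms_monoG hle)) hf
  have hBlow : IsLowerSet (flipAll ⁻¹' A) :=
    fun f f' hle hf => hAup (flipAll_antitone' hle) hf
  have hAB : flipAll ⁻¹' (flipAll ⁻¹' A) = A := by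
    ext f
    simp only [Set.mem_preimage, flipAll_involutive f]
  have cube := card_inter_le_of_cube (isLowerSet_DqM h𝒯 q) hAup hBlow hAB
  have e1 : ((QFM F 𝒯).filter fun x => x.2 = q ∧ EBTM F x ∈ 𝓔).card =
      (Finset.univ.filter (· ∈ DqM F 𝒯 q ∩ A)).card := by
    refine Finset.card_bij' (fun x _ => x.1) (fun f _ => (f, q)) ?_ ?_ ?_ ?_
    · intro x hx
      rw [Finset.mem_filter, mem_QFM] at hx
      obtain ⟨⟨-, ht⟩, hq, hE⟩ := hx
      rw [Finset.mem_filter]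
      refine ⟨Finset.mem_univ _, ?_, ?_⟩
      · show (x.1, typM F q) ∈ 𝒯
        rw [← hq]; exact ht
      · show Sum.inl '' EBM F q ∪ farAtoms x.1 ∈ 𝓔
        rw [← hq]; exact hE
    · intro f hf
      rw [Finset.mem_filter] at hf
      obtain ⟨-, hD, hE⟩ := hf
      rw [Finset.mem_filter, mem_QFM]
      exact ⟨⟨hl, hD⟩, rfl, hE⟩
    · intro x hx
      rw [Finset.mem_filter] at hx
      exact Prod.ext rfl hx.2.1.symm
    · intro f _
      rfl
  have e2 : ((QFM F 𝒯).filter fun x => x.2 = q ∧ EBFM F x ∈ 𝓔).card =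
      (Finset.univ.filter (· ∈ DqM F 𝒯 q ∩ flipAll ⁻¹' A)).card := by
    refine Finset.card_bij' (fun x _ => x.1) (fun f _ => (f, q)) ?_ ?_ ?_ ?_
    · intro x hx
      rw [Finset.mem_filter, mem_QFM] at hx
      obtain ⟨⟨-, ht⟩, hq, hE⟩ := hx
      rw [Finset.mem_filter]
      refine ⟨Finset.mem_univ _, ?_, ?_⟩
      · show (x.1, typM F q) ∈ 𝒯
        rw [← hq]; exact ht
      · show Sum.inl '' EBM F q ∪ farAtoms (flipAll x.1) ∈ 𝓔
        rw [← hq]; exact hE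
    · intro f hf
      rw [Finset.mem_filter] at hf
      obtain ⟨-, hD, hE⟩ := hf
      rw [Finset.mem_filter, mem_QFM]
      exact ⟨⟨hl, hD⟩, rfl, hE⟩
    · intro x hx
      rw [Finset.mem_filter] at hx
      exact Prod.ext rfl hx.2.1.symm
    · intro f _
      rfl
  rw [e1, e2]
  exact cube

omit [Nonempty ι] in
/-- **THE INEQUALITY WITH FAR ARMS FROM THE INEQUALITY OF THE RECORD**. -/
theorem card_le_crossGenFarM (hineq : IneqM F (ι := ι)) (h𝒯 : IsUpFM F 𝒯) (h𝓔 : IsUpperSet 𝓔) :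
    ((QFM F 𝒯).filter fun x => ERFM F x ∈ 𝓔).card ≤ ((QFM F 𝒯).filter fun x => EBFM F x ∈ 𝓔).card := by
  -- sum over the far-arm bits, then over the points
  have h1 : ((QFM F 𝒯).filter fun x => ERFM F x ∈ 𝓔).card =
      ∑ f : Config κ, ((QFM F 𝒯).filter fun x => x.1 = f ∧ ERFM F x ∈ 𝓔).card := by
    rw [Finset.card_eq_sum_card_fiberwise (f := Prod.fst) (t := Finset.univ) (fun _ _ => Finset.mem_univ _)]
    refine Finset.sum_congr rfl fun f _ => ?_
    rw [Finset.filter_filter]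
    congr 1
    apply Finset.filter_congr
    intro x _
    exact and_comm
  have h2 : ((QFM F 𝒯).filter fun x => EBTM F x ∈ 𝓔).card =
      ∑ f : Config κ, ((QFM F 𝒯).filter fun x => x.1 = f ∧ EBTM F x ∈ 𝓔).card := by
    rw [Finset.card_eq_sum_card_fiberwise (f := Prod.fst) (t := Finset.univ) (fun _ _ => Finset.mem_univ _)]
    refine Finset.sum_congr rfl fun f _ => ?_
    rw [Finset.filter_filter]
    congr 1
    apply Finset.filter_congr
    intro x _
    exact and_comm
  have h3 : ((QFM F 𝒯).filter fun x => EBTM F x ∈ 𝓔).card =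
      ∑ q : PtG W ι, ((QFM F 𝒯).filter fun x => x.2 = q ∧ EBTM F x ∈ 𝓔).card := by
    rw [Finset.card_eq_sum_card_fiberwise (f := Prod.snd) (t := Finset.univ) (fun _ _ => Finset.mem_univ _)]
    refine Finset.sum_congr rfl fun q _ => ?_
    rw [Finset.filter_filter]
    congr 1
    apply Finset.filter_congr
    intro x _
    exact and_comm
  have h4 : ((QFM F 𝒯).filter fun x => EBFM F x ∈ 𝓔).card =
      ∑ q : PtG W ι, ((QFM F 𝒯).filter fun x => x.2 = q ∧ EBFM F x ∈ 𝓔).card := by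
    rw [Finset.card_eq_sum_card_fiberwise (f := Prod.snd) (t := Finset.univ) (fun _ _ => Finset.mem_univ _)]
    refine Finset.sum_congr rfl fun q _ => ?_
    rw [Finset.filter_filter]
    congr 1
    apply Finset.filter_congr
    intro x _
    exact and_comm
  calc ((QFM F 𝒯).filter fun x => ERFM F x ∈ 𝓔).card
      = ∑ f : Config κ, ((QFM F 𝒯).filter fun x => x.1 = f ∧ ERFM F x ∈ 𝓔).card := h1
    _ ≤ ∑ f : Config κ, ((QFM F 𝒯).filter fun x => x.1 = f ∧ EBTM F x ∈ 𝓔).card :=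
        Finset.sum_le_sum fun f _ => card_frozen_leM hineq h𝒯 h𝓔 f
    _ = ((QFM F 𝒯).filter fun x => EBTM F x ∈ 𝓔).card := h2.symm
    _ = ∑ q : PtG W ι, ((QFM F 𝒯).filter fun x => x.2 = q ∧ EBTM F x ∈ 𝓔).card := h3
    _ ≤ ∑ q : PtG W ι, ((QFM F 𝒯).filter fun x => x.2 = q ∧ EBFM F x ∈ 𝓔).card :=
        Finset.sum_le_sum fun q _ => card_far_leM h𝒯 h𝓔 q
    _ = ((QFM F 𝒯).filter fun x => EBFM F x ∈ 𝓔).card := h4.symm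

end Thm

end CrossArm

end Summit.Ventures.PercRepro2
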